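import Summits.QuantumFields.BalabanUV.Beta.EriceRemainderEnclosureHistoryAutonomyComparisonAgeCompositionNextRow

/-!
# EriceRemainderEnclosureHistoryAutonomyComparisonAgeCompositionNextRowAges — (E113d) route (N), first order: THE NEXT-ROW CERTIFICATE AGE BY AGE — THE
# LINEAR «YOUNG–OLD INEQUALITY».  Along any box history the damped block of ONE age `k` in row `m+1` is the block of row `m` shifted by one lag and
# multiplied by the SINGLE factor `ρ_k(m) = (h(m+k+1)∕h(m+k))³·g(m+k+1)` (**`age_block_shift`** — plus one more entry at the far end), so the lag-wise
# deficits of (E113b) `flow_nonneg_of_next_row_top` (`θ_m` = the top entry `F(m) = KA 1 m 0`) are bounded AGE BY AGE and LINEARLY IN THE PROFILE: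
#     `Σ_{1≤l<K} (KA 1 m l − F(m)·KA 1 (m+1) (l−1))₊ ≤ Σ_{1≤k<K} (1 − F(m)ρ_k(m))₊ · Σ_{1≤l<k} KL k m l`
# (**`deficits_le_age_split`**).  Hence THE END for every profile, damping, horizon under the displayed «young–old inequality»
#     (YO)   `F(m) + Σ_{1≤k<K} (1 − F(m)·ρ_k(m))₊ · (x^g_k(m) − KL k m 0) ≤ 1`   at every pin
# (`x^g_k(m) = Σ_{l<k} KL k m l` the damped row mass of age `k`) — **`flow_nonneg_of_young_old_inequality`**.  READING (README
# `HOME/b2b-balaban-beta-d4-p2/g94/README.md` §3–§4): undamped, `ρ_k(m) = (a_{m+k}∕a_{m+k+1})^{3∕2} ≥ ((m+k)∕(m+k+1))^{3∕2}` is `≈ 1` for old ages, so (YO)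
# charges an OLD age only `(1−F)·(its mass)` and a YOUNG age at most its mass beyond the top entry; with `Φ_F(m)` := the left side, the light-load END is
# `Φ_0 = T ≤ 1`, and NUMERICALLY (kit jobs of README §5) `sup Φ ≤ 0.72` over every admissible configuration up to range `1024` — INCLUDING the region
# where `T → 1.2` ((E113c)) — with two-age asymptotic limit `≈ 0.85`: (YO) is the LINEAR programme the successor's window certificates ((E112e)-style weak
# duality) should now bound, in place of `T ≤ 1`.

Cell `pub-balaban`, β-function sub-cell, BINDER row D4 «RemainderConst leaves for Bałaban's split» (`HOME/BINDER-OWNERS.md`; owner lineage `b2b-balaban-beta-an4`;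
this file by co-owner #2 lineage `b2b-balaban-beta-d4-p2`, generation 94), β-FLOW TEAM duty (1), FREEZE (0) honoured (def-free; imports (E113b); uses (E113b)
`flow_nonneg_of_next_row_top`, (E80a) `weight_nonneg`, (E80b) `aggregate_eq_sum` BY NAME; the display of `KL`, `KA`, `RA` is (E86i)'s VERBATIM).

HONEST FRAMING (page 1, verbatim and binding).  *"Discharging BetaPertH makes Bałaban's UV stability UNCONDITIONAL — a real constructive-QFT result; it is
NOT the continuum limit and NOT the Clay problem."*  THIS FILE DISCHARGES NOTHING OF THE KIND.  Elementary real analysis about ABSTRACT functionals on a box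
]0,γ]^ℕ with displayed floors, profiles and signs, and the FIRST-ORDER renewal objects of route (N) built from them — hypotheses of a census, not facts; the
form, signs, ages and moments of Bałaban's (1.22) limit functional are NOT PRINTED ([I] p. 298; GAPS G-t4-U2-1∕-2) and NOT asserted.  Row D4 class
UNCHANGED (critical-path width 0; instance 0∕1; D4 DISCHARGE NO DATE).  HONEST DEPENDENCY: continuum YM on T⁴ ⇐ BetaPertH ∧ nine spine estimates (0/9
proved); BetaPertH ⇐ (D1) ∧ (D4) ∧ CAP+tail; G-an2-4 gates asym, D1 and NE2/3/4.

NOT CLAIMED: (YO) along admissible flows for every profile (OPEN, README §6 (1)); anything printed — NOT B12 Thm 2, NOT BetaPertH.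

WHAT IS PROVED ([folklore]; 0 `def`, 0 sorry).  `age_block_shift`, `aggregate_one_eq`, **`deficits_le_age_split`**, **`flow_nonneg_of_young_old_inequality`**.
-/
noncomputable section
open Finset

namespace Summit.QuantumFields.BalabanUV.Beta.EriceRemainderEnclosureHistoryAutonomyComparisonAgeCompositionNextRowAges

open Literature.MathematicalPhysics.QuantumFieldTheory.Balaban1983to89
open Literature.MathematicalPhysics.QuantumFieldTheory.Balaban1983to89.T4BetaStationary
open Summit.QuantumFields.BalabanUV.Beta.EriceRemainderEnclosureHistoryAutonomyComparisonAgeCompositionNextRow (flow_nonneg_of_next_row_top)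
open Summit.QuantumFields.BalabanUV.Beta.EriceRemainderEnclosureHistoryAutonomyComparisonAgeCompositionIdentification (weight_nonneg)
open Summit.QuantumFields.BalabanUV.Beta.EriceRemainderEnclosureHistoryAutonomyComparisonAgeCompositionChainWiring (aggregate_eq_sum)

variable {γ : ℝ} {L : ℕ → ℝ} {K : ℕ} {h g : ℕ → ℝ} {KL : ℕ → ℕ → ℕ → ℝ}

/-- **ONE AGE, TWO CONSECUTIVE ROWS.**  For `l ≥ 1`: `ρ_k(m)·KL k m l ≤ KL k (m+1) (l−1)` with `ρ_k(m) = (h(m+k+1)∕h(m+k))³·g(m+k+1)` — equality inside the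
age's window (`l < k`: the same damping product times `g(m+k+1)`, the level one scale finer), and `0 ≤ KL k (m+1) (k−1)` at its far end. [folklore] -/
theorem age_block_shift (hL : ∀ k, 0 ≤ L k) (hh0 : ∀ t, 0 < h t) (hg : ∀ t, 0 < g t ∧ g t ≤ 1)
    (hKL : ∀ k n l, KL k n l = if 0 < k ∧ k < K ∧ l < k then L k * h (n + k) ^ 3 / 2 * ∏ t ∈ Ico (n + 1 + l) (n + k + 1), g t else 0)
    (m k l : ℕ) (hl : 1 ≤ l) :
    (h (m + k + 1) / h (m + k)) ^ 3 * g (m + k + 1) * KL k m l ≤ KL k (m + 1) (l - 1) := by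
  have hKL0 := weight_nonneg hL hh0 hg hKL
  by_cases hc : 0 < k ∧ k < K ∧ l < k
  · refine le_of_eq ?_
    rw [hKL k m l, if_pos hc, hKL k (m + 1) (l - 1), if_pos ⟨hc.1, hc.2.1, by omega⟩,
      show m + 1 + 1 + (l - 1) = m + 1 + l by omega, show m + 1 + k + 1 = m + k + 1 + 1 by ring, show m + 1 + k = m + k + 1 by ring,
      prod_Ico_succ_top (show m + 1 + l ≤ m + k + 1 by omega)]
    have hne : h (m + k) ≠ 0 := (hh0 _).ne'
    field_simp
  · rw [hKL k m l, if_neg hc, mul_zero]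
    exact hKL0 k (m + 1) (l - 1)

/-- The aggregate over all ages is the sum of the lone kernels: `KA 1 m l = Σ_{1≤k<K} KL k m l`. [folklore] -/
theorem aggregate_one_eq (hK : 1 ≤ K) {KA : ℕ → ℕ → ℕ → ℝ} (hKA : ∀ i m l, KA i m l = KL i m l + KA (i + 1) m l) (hKAtop : ∀ m l, KA K m l = 0)
    (m l : ℕ) : KA 1 m l = ∑ k ∈ Ico 1 K, KL k m l := by
  have := aggregate_eq_sum (n := K - 1) hKA (fun m l => by rw [Nat.sub_add_cancel hK]; exact hKAtop m l) (show 1 ≤ K - 1 + 1 by omega) m l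
  rwa [Nat.sub_add_cancel hK] at this

/-- **THE DEFICITS OF THE NEXT-ROW CERTIFICATE, AGE BY AGE.**  For any `F ≥ 0`:
`Σ_{l<K, l≠0} (KA 1 m l − F·KA 1 (m+1) (l−1))₊ ≤ Σ_{1≤k<K} (1 − F·ρ_k(m))₊·Σ_{1≤l<k} KL k m l`. [folklore] -/
theorem deficits_le_age_split (hL : ∀ k, 0 ≤ L k) (hh0 : ∀ t, 0 < h t) (hg : ∀ t, 0 < g t ∧ g t ≤ 1) (hK : 1 ≤ K)
    (hKL : ∀ k n l, KL k n l = if 0 < k ∧ k < K ∧ l < k then L k * h (n + k) ^ 3 / 2 * ∏ t ∈ Ico (n + 1 + l) (n + k + 1), g t else 0)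
    {KA : ℕ → ℕ → ℕ → ℝ} (hKA : ∀ i m l, KA i m l = KL i m l + KA (i + 1) m l) (hKAtop : ∀ m l, KA K m l = 0)
    (m : ℕ) {F : ℝ} (hF : 0 ≤ F) :
    ∑ l ∈ range K, (if l = 0 then 0 else max 0 (KA 1 m l - F * KA 1 (m + 1) (l - 1)))
      ≤ ∑ k ∈ Ico 1 K, max 0 (1 - F * ((h (m + k + 1) / h (m + k)) ^ 3 * g (m + k + 1))) * ∑ l ∈ Ico 1 k, KL k m l := by
  have hKL0 := weight_nonneg hL hh0 hg hKL
  set ρ : ℕ → ℝ := fun k => (h (m + k + 1) / h (m + k)) ^ 3 * g (m + k + 1) with hρ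
  -- lag by lag
  have hlag : ∀ l, 1 ≤ l → max 0 (KA 1 m l - F * KA 1 (m + 1) (l - 1)) ≤ ∑ k ∈ Ico 1 K, max 0 (1 - F * ρ k) * KL k m l := by
    intro l hl
    refine max_le (sum_nonneg fun k _ => mul_nonneg (le_max_left _ _) (hKL0 k m l)) ?_
    rw [aggregate_one_eq hK hKA hKAtop m l, aggregate_one_eq hK hKA hKAtop (m + 1) (l - 1)]
    have h1 : F * ∑ k ∈ Ico 1 K, ρ k * KL k m l ≤ F * ∑ k ∈ Ico 1 K, KL k (m + 1) (l - 1) :=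
      mul_le_mul_of_nonneg_left (sum_le_sum fun k _ => age_block_shift hL hh0 hg hKL m k l hl) hF
    calc ∑ k ∈ Ico 1 K, KL k m l - F * ∑ k ∈ Ico 1 K, KL k (m + 1) (l - 1)
        ≤ ∑ k ∈ Ico 1 K, KL k m l - F * ∑ k ∈ Ico 1 K, ρ k * KL k m l := by linarith
      _ = ∑ k ∈ Ico 1 K, (1 - F * ρ k) * KL k m l := by rw [mul_sum, ← sum_sub_distrib]; exact sum_congr rfl fun k _ => by ring
      _ ≤ ∑ k ∈ Ico 1 K, max 0 (1 - F * ρ k) * KL k m l :=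
          sum_le_sum fun k _ => mul_le_mul_of_nonneg_right (le_max_right _ _) (hKL0 k m l)
  -- sum over the lags `1 ≤ l < K`, exchange, and drop the lags beyond each age's window
  have hzero : ∀ k l, k ≤ l → KL k m l = 0 := fun k l hkl => by rw [hKL, if_neg (by omega)]
  calc ∑ l ∈ range K, (if l = 0 then 0 else max 0 (KA 1 m l - F * KA 1 (m + 1) (l - 1)))
      = ∑ l ∈ Ico 1 K, max 0 (KA 1 m l - F * KA 1 (m + 1) (l - 1)) := by
        rw [range_eq_Ico, sum_eq_sum_Ico_succ_bot (show 0 < K by omega), if_pos rfl, zero_add]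
        exact sum_congr rfl fun l hl => if_neg (by have := (mem_Ico.mp hl).1; omega)
    _ ≤ ∑ l ∈ Ico 1 K, ∑ k ∈ Ico 1 K, max 0 (1 - F * ρ k) * KL k m l := sum_le_sum fun l hl => hlag l (mem_Ico.mp hl).1
    _ = ∑ k ∈ Ico 1 K, max 0 (1 - F * ρ k) * ∑ l ∈ Ico 1 K, KL k m l := by rw [sum_comm]; simp_rw [mul_sum]
    _ = ∑ k ∈ Ico 1 K, max 0 (1 - F * ρ k) * ∑ l ∈ Ico 1 k, KL k m l := by
        refine sum_congr rfl fun k hk => ?_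
        congr 1
        have hk' := mem_Ico.mp hk
        rw [← sum_Ico_consecutive _ hk'.1 hk'.2.le, sum_eq_zero (s := Ico k K) fun l hl => hzero k l (mem_Ico.mp hl).1, add_zero]

/-- **ROUTE (N), FIRST ORDER — THE END UNDER THE YOUNG–OLD INEQUALITY (ANY PROFILE, ANY DAMPING, ANY HORIZON).**  `L ≥ 0` on the ages `< K` (`K ≥ 1`),
`h` a box history, `g` a damping with `0 < g ≤ 1`, `KL`, `KA`, `RA` as displayed ((E86i) verbatim), horizon `N ≥ K`.  IF at every pin `m`, with `F(m) =
KA 1 m 0` (the top entry) and `ρ_k(m) = (h(m+k+1)∕h(m+k))³·g(m+k+1)`,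
`F(m) + Σ_{1≤k<K} (1 − F(m)ρ_k(m))₊·Σ_{1≤l<k} KL k m l ≤ 1`, THEN `0 ≤ ε m ≤ e m` for every admissible excess. [folklore] -/
theorem flow_nonneg_of_young_old_inequality (hL : ∀ k, 0 ≤ L k) (hh : SeqBox γ h) (hg : ∀ t, 0 < g t ∧ g t ≤ 1) (hK : 1 ≤ K)
    {N : ℕ} (hKN : K ≤ N)
    (hKL : ∀ k n l, KL k n l = if 0 < k ∧ k < K ∧ l < k then L k * h (n + k) ^ 3 / 2 * ∏ t ∈ Ico (n + 1 + l) (n + k + 1), g t else 0)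
    {KA : ℕ → ℕ → ℕ → ℝ} {RA : ℕ → (ℕ → ℝ) → ℕ → ℝ}
    (hRA : ∀ i v m, RA i v m = ∑ l ∈ range K, KA i m l * v (m + 1 + l))
    (hKA : ∀ i m l, KA i m l = KL i m l + KA (i + 1) m l) (hKAtop : ∀ m l, KA K m l = 0)
    (hyo : ∀ m, KA 1 m 0 + ∑ k ∈ Ico 1 K, max 0 (1 - KA 1 m 0 * ((h (m + k + 1) / h (m + k)) ^ 3 * g (m + k + 1)))
      * ∑ l ∈ Ico 1 k, KL k m l ≤ 1)
    {e ε : ℕ → ℝ} (he0 : ∀ m, 0 ≤ e m) (hea : ∀ m, e (m + 1) ≤ e m)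
    (hεt : ∀ m, N < m → ε m = 0) (hεrec : ∀ m, ε m = e m - RA 1 ε m) : ∀ m, 0 ≤ ε m ∧ ε m ≤ e m := by
  have hh0 : ∀ n, 0 < h n := fun n => (hh n).1
  have hKL0 := weight_nonneg hL hh0 hg hKL
  have hF0 : ∀ m, 0 ≤ KA 1 m 0 := fun m => by
    rw [aggregate_one_eq hK hKA hKAtop]; exact sum_nonneg fun k _ => hKL0 k m 0
  refine flow_nonneg_of_next_row_top hL hh hg hK hKN hKL hRA hKA hKAtop (fun m => ?_) he0 hea hεt hεrec
  have hd := deficits_le_age_split hL hh0 hg hK hKL hKA hKAtop m (hF0 m)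
  linarith [hyo m]

end Summit.QuantumFields.BalabanUV.Beta.EriceRemainderEnclosureHistoryAutonomyComparisonAgeCompositionNextRowAges

end
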